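import Summits.Ventures.CertifiedManyBodySolver.Observables.PairODLROCeilingTL
import Summits.Ventures.CertifiedManyBodySolver.Certificates.HubbardSquare_n7o8_stripeStar_instances
import HarnessLib

/-!
# Box rows ⇒ Bragg-weight ceilings at ANY wavevector: the phase-weighted box ceiling, its staggered
# `(π,…,π)` form, and the `3 × 3` box rows of record (Néel weight, uniform magnetisation) read as theorems
# about every torus-limit ground state

HONEST FRAMING: first certified bounds on pairing observables; not a superconductivity verdict; every number
certified (two lineages + referee) or labelled float.  Pure harmonic analysis + finite `D₄` bookkeeping; zero compute;
NO definition, no named fact, no `sorry`.  A CEILING on a Bragg weight says nothing about the presence of order.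

Cell hubbard-obs (D-0042 crew 1), seat hubbard-obs-p3 (CONTROLS: density / spin structure factors), gen 2.  The lead's
ruling (ss2)/(ao3) approved ONE control-side row for certification on the STEP-0 object: the `(π,π)` STAGGERED `3 × 3`
BOX ROW `F_s3_stag = (1/81) Σ_{x,y ∈ 3×3} (−1)^{|x−y|₁} ω(𝐒_x·𝐒_y)` (HOME/hubbard-obs-p3/TARGET.md §3 C2.3′, §9 M4;
float preview `≤ 0.2656` at `(U,n,t′) = (8, 7/8, −1/4)` vs the plaquette-kernel ceilings of record `0.3399425` (#259) /
`0.3360872` (#263), `Certificates/HubbardSquare_n7o8_stripeStar_instances.lean`).  This file is the READING of that row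
(and of its `q = 0` twins) as a theorem, generic in the anchor and in the certified literal, so that the certificate —
when it lands as a `Rows/DopedTLCorr.lean` orbit-mean cell — closes a Néel-weight ceiling by ONE application:

* §1 (any `d`, any finite measure `μ` representing a lattice function `C : ℤᵈ → ℂ`, ANY finite family of lattice
  points `p : ι → ℤᵈ` over `B : Finset ι`, ANY wavevector `Q ∈ ℝᵈ`):
  **`|B|² · braggWeight μ ![Q] ≤ Σ_{a,b∈B} Re (e^{−i(p_b−p_a)·Q} C(p_b − p_a))`**
  (`sq_card_mul_braggWeight_le_sum_re_phase`; kernel `|Σ_{a∈B} e^{i p_a·(ξ−Q)}|² ≥ 0`, `= |B|²` on `Q + 2πℤᵈ`) — the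
  `Q`-shifted twin of p1's `sq_card_mul_braggWeight_zero_le` (`PairODLROCeilingTL.lean`) and the finite-set form of
  p3-g0's `braggWeight_single_le_re_boxPairMean` (`BraggWeightBoxCeiling.lean`, boxes `[0,M)ᵈ` only).
* §1′ the STAGGERED form at `Q = (π,…,π)`: the phase is the sign `(−1)^{Σ_i (p_b−p_a)_i}`
  (`re_exp_neg_pi_mul_eq`, `sq_card_mul_braggWeight_pi_le_sum_stag`).
* §2 (`d = 2`, the `3 × 3` box, `D₄`-INVARIANT `C`): the 81 terms collapse onto the six `D₄` classes with the pair
  counts `9, 24, 16, 12, 16, 4` of the box, signs `+ − + + − +` at `(π,π)`: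
  **`braggWeight μ ![(π,π)] ≤ (9·Re C(0,0) − 24·Re C(1,0) + 16·Re C(1,1) + 12·Re C(2,0) − 16·Re C(2,1) + 4·Re C(2,2))/81`**
  (`d4Invariant_box3_values`, `braggWeight_pi_le_boxStag3`) and the unsigned `q = 0` twin (`braggWeight_zero_le_box3`,
  from `sq_card_mul_braggWeight_zero_le_sum_family`).
* §3 (states): the `D₄`-orbit-mean correlations `spinOrbitCorr ω` / `chargeOrbitCorr ω` of the stripe-star dictionary ARE
  `D₄`-invariant (`spinOrbitCorr_d4Vec`, `chargeOrbitCorr_d4Vec`; `spinOrbitCorr_re` is the orbit-mean currency), so for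
  every state `ω` and every finite measure representing them: the Néel weight `μ((π,π) + 2πℤ²)` is bounded by the `3 × 3`
  staggered spin box functional (`neel_braggWeight_le_boxStag3`), the squared uniform magnetisation `μ(2πℤ²)` by the
  unsigned one (`uniformSpin_braggWeight_le_box3`), the `q = 0` density-fluctuation (phase-separation) weight by the
  connected density box functional (`densityFluct_braggWeight_le_box3`); the TORUS-LIMIT forms
  (`neel_braggWeight_le_of_boxStag3_classRow`, `uniformSpin_braggWeight_le_of_box3_classRow`) take the row in the
  engine's currency — the `r = 0` class folded as `¾(7/8 − 2·docc)` (`spinCorr_zero`), the other five classes as orbit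
  means `8⁻¹ Σ_γ C_ω(γ·r)` — with the state binders of `Rows/DopedTLCorr.lean` VERBATIM, for any `t′`; non-vacuity is
  `spinOrbitCorr_representable` / `chargeOrbitCorr_representable`.  Nothing here re-proves #259/#263.

NOT here: no certificate is typed (none has landed for a box row), no operator word is defined (the row's WORD and its
dictionary `(1/8)Σ_γ Re ω(Γ(γ)X) = class form` are the companion definition file's), no number is asserted.  References:
Katznelson, *Harmonic Analysis* I.7; Scalapino, Phys. Rep. 250 (1995) 329, §2; Hirsch, PRB 31 (1985) 4403, (4.7).
-/

noncomputable section

open MeasureTheory Complex Filter Topology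
open scoped Real BigOperators

namespace Summit.Ventures.CertifiedManyBodySolver.Observables

/-! ## §1  The phase-weighted box ceiling at an arbitrary wavevector -/

section Phase

variable {d : ℕ} {C : (Fin d → ℤ) → ℂ} (μ : Measure (EuclideanSpace ℝ (Fin d))) [IsFiniteMeasure μ]

/-- **Phase-weighted box ceiling at any wavevector.**  For a finite measure `μ` on `ℝᵈ` representing
`C : ℤᵈ → ℂ` (`∫ e^{i r·ξ} dμ = C r`), any finite family of lattice points `p : ι → ℤᵈ` over `B`, and any `Q ∈ ℝᵈ`:
`|B|² · μ(Q + 2πℤᵈ) ≤ Σ_{a,b∈B} Re (e^{−i(p_b − p_a)·Q} · C(p_b − p_a))`.  Kernel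
`K(ξ) = Σ_{a,b} cos((p_b − p_a)·(ξ − Q)) = (Σ_a cos p_a·(ξ−Q))² + (Σ_a sin p_a·(ξ−Q))² ≥ 0`, `K = |B|²` on `Q + 2πℤᵈ`.
Repetitions in `p` are allowed (no injectivity is used): finite boxes may be indexed by `ℕ × ℕ`. [folklore] -/
theorem sq_card_mul_braggWeight_le_sum_re_phase
    (hμ : ∀ r : Fin d → ℤ, ∫ ξ, exp ((∑ i, (r i : ℝ) * ξ i : ℝ) * I) ∂μ = C r)
    {ι : Type*} (B : Finset ι) (p : ι → (Fin d → ℤ)) (Q : Fin d → ℝ) :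
    ((B.card : ℝ)) ^ 2 * braggWeight μ ![Q] ≤
      ∑ a ∈ B, ∑ b ∈ B, (exp (-((((∑ i, ((p b - p a) i : ℝ) * Q i : ℝ)) : ℂ) * I)) * C (p b - p a)).re := by
  set A : Set (EuclideanSpace ℝ (Fin d)) := ⋃ j : Fin 1, braggSet ((![Q]) j) with hA
  set K : EuclideanSpace ℝ (Fin d) → ℝ :=
    fun ξ => ∑ a ∈ B, ∑ b ∈ B, Real.cos (∑ i, ((p b - p a) i : ℝ) * (ξ i - Q i)) with hKdef
  have hθ : ∀ (ξ : EuclideanSpace ℝ (Fin d)) (a b : ι),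
      (∑ i, ((p b - p a) i : ℝ) * (ξ i - Q i)) =
        (∑ i, (p b i : ℝ) * (ξ i - Q i)) - ∑ i, (p a i : ℝ) * (ξ i - Q i) := by
    intro ξ a b
    rw [← Finset.sum_sub_distrib]
    refine Finset.sum_congr rfl fun i _ => ?_
    rw [Pi.sub_apply]; push_cast; ring
  have hKnn : ∀ ξ, 0 ≤ K ξ := by
    intro ξ
    rw [hKdef]; dsimp only
    simp_rw [hθ ξ]
    exact sum_sum_cos_sub_nonneg B (fun a : ι => ∑ i, (p a i : ℝ) * (ξ i - Q i))
  have hKcont : Continuous K := by rw [hKdef]; fun_prop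
  have hKbd : ∀ ξ, ‖K ξ‖ ≤ ((B.card : ℝ)) ^ 2 := by
    intro ξ
    rw [hKdef, Real.norm_eq_abs]; dsimp only
    refine (Finset.abs_sum_le_sum_abs _ _).trans ?_
    calc ∑ a ∈ B, |∑ b ∈ B, Real.cos (∑ i, ((p b - p a) i : ℝ) * (ξ i - Q i))|
        ≤ ∑ a ∈ B, ∑ b ∈ B, |Real.cos (∑ i, ((p b - p a) i : ℝ) * (ξ i - Q i))| :=
          Finset.sum_le_sum fun a _ => Finset.abs_sum_le_sum_abs _ _
      _ ≤ ∑ _a ∈ B, ∑ _b ∈ B, (1 : ℝ) :=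
          Finset.sum_le_sum fun a _ => Finset.sum_le_sum fun b _ => Real.abs_cos_le_one _
      _ = ((B.card : ℝ)) ^ 2 := by
          simp only [Finset.sum_const, nsmul_eq_mul, mul_one]; ring
  have hKint : Integrable K μ :=
    Integrable.mono' (integrable_const _) hKcont.aestronglyMeasurable (ae_of_all _ hKbd)
  -- on `Q + 2πℤᵈ` every cosine is `1`
  have hKA : ∀ ξ ∈ A, K ξ = ((B.card : ℝ)) ^ 2 := by
    intro ξ hξ
    rw [hA, Set.mem_iUnion] at hξ
    obtain ⟨j, hj⟩ := hξ
    obtain rfl : j = 0 := Subsingleton.elim _ _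
    rw [Matrix.cons_val_zero] at hj
    obtain ⟨mv, hm⟩ := hj
    rw [hKdef]; dsimp only
    have hcos : ∀ a b : ι, Real.cos (∑ i, ((p b - p a) i : ℝ) * (ξ i - Q i)) = 1 := by
      intro a b
      have : (∑ i, ((p b - p a) i : ℝ) * (ξ i - Q i)) = ((∑ i, (p b - p a) i * mv i : ℤ) : ℝ) * (2 * π) := by
        push_cast
        rw [Finset.sum_mul]
        exact Finset.sum_congr rfl fun i _ => by rw [hm i]; ring
      rw [this, Real.cos_int_mul_two_pi]
    simp_rw [hcos]
    simp only [Finset.sum_const, nsmul_eq_mul, mul_one]; ring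
  have hAmeas : MeasurableSet A := MeasurableSet.iUnion fun j => measurableSet_braggSet _
  have hcosInt : ∀ a b : ι,
      Integrable (fun ξ : EuclideanSpace ℝ (Fin d) => Real.cos (∑ i, ((p b - p a) i : ℝ) * (ξ i - Q i))) μ := by
    intro a b
    refine Integrable.mono' (integrable_const (1 : ℝ)) (by fun_prop) (ae_of_all _ fun ξ => ?_)
    rw [Real.norm_eq_abs]; exact Real.abs_cos_le_one _
  have hcosI : ∀ a b : ι, ∫ ξ, Real.cos (∑ i, ((p b - p a) i : ℝ) * (ξ i - Q i)) ∂μ =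
      (exp (-((((∑ i, ((p b - p a) i : ℝ) * Q i : ℝ)) : ℂ) * I)) * C (p b - p a)).re := by
    intro a b
    rw [← integral_exp_shift μ hμ Q (p b - p a)]
    have hint := integrable_exp_ofReal_mul_I μ
      (φ := fun ξ : EuclideanSpace ℝ (Fin d) => ∑ i, ((p b - p a) i : ℝ) * (ξ i - Q i)) (by fun_prop)
    have h2 := integral_re hint
    simp only [RCLike.re_to_complex] at h2
    rw [← h2]
    exact integral_congr_ae (ae_of_all _ fun ξ => by simp only [Complex.exp_ofReal_mul_I_re])
  have hKI : ∫ ξ, K ξ ∂μ =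
      ∑ a ∈ B, ∑ b ∈ B, (exp (-((((∑ i, ((p b - p a) i : ℝ) * Q i : ℝ)) : ℂ) * I)) * C (p b - p a)).re := by
    rw [hKdef]; dsimp only
    rw [integral_finsetSum _ fun a _ => integrable_finsetSum _ fun b _ => hcosInt a b]
    refine Finset.sum_congr rfl fun a _ => ?_
    rw [integral_finsetSum _ fun b _ => hcosInt a b]
    exact Finset.sum_congr rfl fun b _ => hcosI a b
  unfold braggWeight
  calc ((B.card : ℝ)) ^ 2 * (μ A).toReal
      = ∫ _ξ in A, ((B.card : ℝ)) ^ 2 ∂μ := by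
        rw [setIntegral_const, Measure.real, smul_eq_mul, mul_comm]
    _ = ∫ ξ in A, K ξ ∂μ := setIntegral_congr_fun hAmeas fun ξ hξ => (hKA ξ hξ).symm
    _ ≤ ∫ ξ, K ξ ∂μ := setIntegral_le_integral hKint (ae_of_all _ hKnn)
    _ = _ := hKI

/-- The real part of a phase-weighted value at the staggered wavevector: for `r ∈ ℤᵈ`,
`Re (e^{−i π Σ_i r_i} · z) = (−1)^{Σ_i r_i} · Re z` (`cos(nπ) = (−1)^n`, `sin(nπ) = 0`). [folklore] -/
theorem re_exp_neg_pi_mul_eq (r : Fin d → ℤ) (z : ℂ) :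
    (exp (-((((∑ i, (r i : ℝ) * (fun _ : Fin d => π) i : ℝ)) : ℂ) * I)) * z).re =
      (-1 : ℝ) ^ (∑ i, r i) * z.re := by
  have hsum : (∑ i, (r i : ℝ) * (fun _ : Fin d => π) i : ℝ) = ((∑ i, r i : ℤ) : ℝ) * π := by
    push_cast; rw [Finset.sum_mul]
  rw [hsum, show -((((((∑ i, r i : ℤ) : ℝ) * π : ℝ)) : ℂ) * I) = (((-(((∑ i, r i : ℤ) : ℝ) * π) : ℝ)) : ℂ) * I by
    push_cast; ring]
  rw [Complex.mul_re, Complex.exp_ofReal_mul_I_re, Complex.exp_ofReal_mul_I_im, Real.cos_neg, Real.sin_neg,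
    Real.cos_int_mul_pi, Real.sin_int_mul_pi]
  ring

/-- **Staggered box ceiling** (`Q = (π,…,π)`): for every finite family `p : ι → ℤᵈ` over `B`,
`|B|² · μ((π,…,π) + 2πℤᵈ) ≤ Σ_{a,b∈B} (−1)^{Σ_i (p_b − p_a)_i} · Re C(p_b − p_a)` — the staggered structure factor of the
family dominates `|B|²` times the antiferromagnetic Bragg weight. [folklore] -/
theorem sq_card_mul_braggWeight_pi_le_sum_stag
    (hμ : ∀ r : Fin d → ℤ, ∫ ξ, exp ((∑ i, (r i : ℝ) * ξ i : ℝ) * I) ∂μ = C r)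
    {ι : Type*} (B : Finset ι) (p : ι → (Fin d → ℤ)) :
    ((B.card : ℝ)) ^ 2 * braggWeight μ ![(fun _ : Fin d => π)] ≤
      ∑ a ∈ B, ∑ b ∈ B, (-1 : ℝ) ^ (∑ i, (p b - p a) i) * (C (p b - p a)).re := by
  simpa only [re_exp_neg_pi_mul_eq] using sq_card_mul_braggWeight_le_sum_re_phase μ hμ B p (fun _ : Fin d => π)

/-- The unsigned (`Q = 0`) box ceiling for an indexed family (p1's `sq_card_mul_braggWeight_zero_le` allows
repetitions once indexed): `|B|² · μ(2πℤᵈ) ≤ Σ_{a,b∈B} Re C(p_b − p_a)`. [folklore] -/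
theorem sq_card_mul_braggWeight_zero_le_sum_family
    (hμ : ∀ r : Fin d → ℤ, ∫ ξ, exp ((∑ i, (r i : ℝ) * ξ i : ℝ) * I) ∂μ = C r)
    {ι : Type*} (B : Finset ι) (p : ι → (Fin d → ℤ)) :
    ((B.card : ℝ)) ^ 2 * braggWeight μ ![(0 : Fin d → ℝ)] ≤
      ∑ a ∈ B, ∑ b ∈ B, (C (p b - p a)).re := by
  simpa only [Pi.zero_apply, mul_zero, Finset.sum_const_zero, Complex.ofReal_zero, neg_zero, zero_mul,
    Complex.exp_zero, one_mul] using sq_card_mul_braggWeight_le_sum_re_phase μ hμ B p (0 : Fin d → ℝ)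

end Phase

/-! ## §2  The `3 × 3` box (`d = 2`): collapse of the 81 terms onto the six `D₄` classes -/

section Box3

open Literature.MathematicalPhysics.QuantumLattice Literature.Probability.LatticeModels
open DihedralGroup

variable {C : Site 2 → ℂ} (μ : Measure (EuclideanSpace ℝ (Fin 2))) [IsFiniteMeasure μ]

/-- The nineteen non-representative displacements of `{−2,…,2}²` carried to their `D₄`-class representatives
`(1,0), (1,1), (2,0), (2,1), (2,2)` by a `D₄`-invariant lattice function (each by one explicit group element;
`d4Vec` evaluated by `decide`). [cite: Scalapino1995, §2] -/
theorem d4Invariant_box3_values (hC : ∀ (γ : DihedralGroup 4) (v : Site 2), C (d4Vec γ v) = C v) :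
    C ![-1, 0] = C ![1, 0] ∧ C ![0, 1] = C ![1, 0] ∧ C ![0, -1] = C ![1, 0] ∧
    C ![-1, -1] = C ![1, 1] ∧ C ![-1, 1] = C ![1, 1] ∧ C ![1, -1] = C ![1, 1] ∧
    C ![-2, 0] = C ![2, 0] ∧ C ![0, 2] = C ![2, 0] ∧ C ![0, -2] = C ![2, 0] ∧
    C ![-1, 2] = C ![2, 1] ∧ C ![-2, -1] = C ![2, 1] ∧ C ![1, -2] = C ![2, 1] ∧ C ![2, -1] = C ![2, 1] ∧
    C ![-1, -2] = C ![2, 1] ∧ C ![-2, 1] = C ![2, 1] ∧ C ![1, 2] = C ![2, 1] ∧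
    C ![-2, 2] = C ![2, 2] ∧ C ![-2, -2] = C ![2, 2] ∧ C ![2, -2] = C ![2, 2] := by
  have h : ∀ (γ : DihedralGroup 4) (v w : Site 2), d4Vec γ v = w → C w = C v := fun γ v w e => e ▸ hC γ v
  exact ⟨h (r 2) ![1, 0] _ (by decide), h (r 1) ![1, 0] _ (by decide), h (r 3) ![1, 0] _ (by decide),
    h (r 2) ![1, 1] _ (by decide), h (r 1) ![1, 1] _ (by decide), h (r 3) ![1, 1] _ (by decide),
    h (r 2) ![2, 0] _ (by decide), h (r 1) ![2, 0] _ (by decide), h (r 3) ![2, 0] _ (by decide),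
    h (r 1) ![2, 1] _ (by decide), h (r 2) ![2, 1] _ (by decide), h (r 3) ![2, 1] _ (by decide),
    h (sr 0) ![2, 1] _ (by decide), h (sr 1) ![2, 1] _ (by decide), h (sr 2) ![2, 1] _ (by decide),
    h (sr 3) ![2, 1] _ (by decide), h (r 1) ![2, 2] _ (by decide), h (r 2) ![2, 2] _ (by decide),
    h (r 3) ![2, 2] _ (by decide)⟩

/-- **The `3 × 3` staggered box row bounds the Néel weight.**  For a finite measure `μ` representing a
`D₄`-INVARIANT `C : ℤ² → ℂ` (e.g. the `D₄`-orbit-mean spin correlation of a translation-invariant state), the Bragg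
weight at `(π,π)` obeys
`μ((π,π) + 2πℤ²) ≤ (9·Re C(0,0) − 24·Re C(1,0) + 16·Re C(1,1) + 12·Re C(2,0) − 16·Re C(2,1) + 4·Re C(2,2)) / 81`
— the weights are the pair counts `(3−|r₁|)(3−|r₂|)` of the `3 × 3` box summed over each class, the signs
`(−1)^{|r|₁}`.  This is `F_s3_stag` of the controls menu; a CEILING, silent on the presence of order.
[cite: Scalapino1995, §2] -/
theorem braggWeight_pi_le_boxStag3
    (hμ : ∀ r : Site 2, ∫ ξ, exp ((∑ i, (r i : ℝ) * ξ i : ℝ) * I) ∂μ = C r)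
    (hC : ∀ (γ : DihedralGroup 4) (v : Site 2), C (d4Vec γ v) = C v) :
    braggWeight μ ![![π, π]] ≤
      (9 * (C ![0, 0]).re - 24 * (C ![1, 0]).re + 16 * (C ![1, 1]).re + 12 * (C ![2, 0]).re
        - 16 * (C ![2, 1]).re + 4 * (C ![2, 2]).re) / 81 := by
  have h := sq_card_mul_braggWeight_pi_le_sum_stag μ hμ (Finset.range 3 ×ˢ Finset.range 3)
    (fun mn : ℕ × ℕ => (![(mn.1 : ℤ), (mn.2 : ℤ)] : Site 2))
  have hQ : (fun _ : Fin 2 => π) = ![π, π] := by funext i; fin_cases i <;> rfl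
  have hcard : (((Finset.range 3 ×ˢ Finset.range 3).card : ℝ)) ^ 2 = 81 := by
    rw [Finset.card_product, Finset.card_range]; norm_num
  rw [hQ, hcard] at h
  simp only [Finset.sum_product, Finset.sum_range_succ, Finset.sum_range_zero, zero_add, Nat.cast_zero,
    Nat.cast_one, Nat.cast_ofNat, Matrix.cons_sub_cons, Matrix.empty_sub_empty, Fin.sum_univ_two,
    Matrix.cons_val_zero, Matrix.cons_val_one] at h
  norm_num at h
  obtain ⟨e1, e2, e3, e4, e5, e6, e7, e8, e9, e10, e11, e12, e13, e14, e15, e16, e17, e18, e19⟩ :=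
    d4Invariant_box3_values hC
  rw [e1, e2, e3, e4, e5, e6, e7, e8, e9, e10, e11, e12, e13, e14, e15, e16, e17, e18, e19] at h
  rw [le_div_iff₀ (by norm_num : (0 : ℝ) < 81)]
  linarith

/-- **The `3 × 3` unsigned box row bounds the `q = 0` weight.**  Same setting, no signs:
`μ(2πℤ²) ≤ (9·Re C(0,0) + 24·Re C(1,0) + 16·Re C(1,1) + 12·Re C(2,0) + 16·Re C(2,1) + 4·Re C(2,2)) / 81`
(`F_s3` / `F_c3` of the controls menu: squared uniform magnetisation, resp. `q = 0` density-fluctuation weight, when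
`C` is the spin, resp. connected density, orbit-mean correlation).  A CEILING. [cite: Scalapino1995, §2] -/
theorem braggWeight_zero_le_box3
    (hμ : ∀ r : Site 2, ∫ ξ, exp ((∑ i, (r i : ℝ) * ξ i : ℝ) * I) ∂μ = C r)
    (hC : ∀ (γ : DihedralGroup 4) (v : Site 2), C (d4Vec γ v) = C v) :
    braggWeight μ ![(0 : Fin 2 → ℝ)] ≤
      (9 * (C ![0, 0]).re + 24 * (C ![1, 0]).re + 16 * (C ![1, 1]).re + 12 * (C ![2, 0]).re
        + 16 * (C ![2, 1]).re + 4 * (C ![2, 2]).re) / 81 := by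
  have h := sq_card_mul_braggWeight_zero_le_sum_family μ hμ (Finset.range 3 ×ˢ Finset.range 3)
    (fun mn : ℕ × ℕ => (![(mn.1 : ℤ), (mn.2 : ℤ)] : Site 2))
  have hcard : (((Finset.range 3 ×ˢ Finset.range 3).card : ℝ)) ^ 2 = 81 := by
    rw [Finset.card_product, Finset.card_range]; norm_num
  rw [hcard] at h
  simp only [Finset.sum_product, Finset.sum_range_succ, Finset.sum_range_zero, zero_add, Nat.cast_zero,
    Nat.cast_one, Nat.cast_ofNat, Matrix.cons_sub_cons, Matrix.empty_sub_empty] at h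
  norm_num at h
  obtain ⟨e1, e2, e3, e4, e5, e6, e7, e8, e9, e10, e11, e12, e13, e14, e15, e16, e17, e18, e19⟩ :=
    d4Invariant_box3_values hC
  rw [e1, e2, e3, e4, e5, e6, e7, e8, e9, e10, e11, e12, e13, e14, e15, e16, e17, e18, e19] at h
  rw [le_div_iff₀ (by norm_num : (0 : ℝ) < 81)]
  linarith

end Box3

/-! ## §3  States: the `D₄`-orbit-mean correlations are `D₄`-invariant; Néel / uniform / `q = 0`-density
ceilings for translation-invariant states and for torus-limit ground states (row currency) -/

section States

open Matrix Literature.MathematicalPhysics.QuantumLattice Literature.Probability.LatticeModels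
open Literature.MathematicalPhysics.QuantumLattice.ThermodynamicLimit
open HubbardWave0 Literature.MathematicalPhysics.QuantumManyBody.StateRelaxation
open Summit.HubbardSuperconductivity.ManyBodyBootstrap.Bounds
open Literature.MathematicalPhysics.QuantumLattice.FermionSpinMoment
open Summit.Ventures.CertifiedManyBodySolver.Certificates
open Summit.Ventures.CertifiedManyBodySolver.Transport
open Summit.Ventures.CertifiedManyBodySolver.SpinStarTL
open DihedralGroup

/-- **`spinOrbitCorr ω` is `D₄`-invariant** (right multiplication by `γ` permutes the orbit sum;
`sum_univ_d4Vec_d4Vec`). [cite: Scalapino1995, §2] -/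
theorem spinOrbitCorr_d4Vec (ω : InfVolFermionState 2) (γ : DihedralGroup 4) (v : Site 2) :
    spinOrbitCorr ω (d4Vec γ v) = spinOrbitCorr ω v := by
  unfold spinOrbitCorr; rw [sum_univ_d4Vec_d4Vec]

/-- **`chargeOrbitCorr ω` is `D₄`-invariant** (same reindexing). [cite: Scalapino1995, §2] -/
theorem chargeOrbitCorr_d4Vec (ω : InfVolFermionState 2) (γ : DihedralGroup 4) (v : Site 2) :
    chargeOrbitCorr ω (d4Vec γ v) = chargeOrbitCorr ω v := by
  unfold chargeOrbitCorr
  rw [sum_univ_d4Vec_d4Vec (fun w : Site 2 => ω.corr Dc (fermionEmbed (PolySite.shiftEmb w {0}) Dc)) γ v]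

/-- `Re spinOrbitCorr ω r = 8⁻¹ Σ_γ C_ω(γ·r)` — the orbit MEAN of the spin two-point function `spinCorr ω`
(the row currency of a `D₄`-reduced certificate: one representative per class). [folklore] -/
theorem spinOrbitCorr_re (ω : InfVolFermionState 2) (r : Site 2) :
    (spinOrbitCorr ω r).re = (8 : ℝ)⁻¹ * ∑ g : DihedralGroup 4, Certificates.spinCorr ω (d4Vec g r) := by
  rw [spinOrbitCorr, Complex.re_ofReal_mul, Complex.re_sum]
  exact congrArg _ (Finset.sum_congr rfl fun g _ => re_spinCorrSum _)

variable (ω : InfVolFermionState 2) (μ : Measure (EuclideanSpace ℝ (Fin 2))) [IsFiniteMeasure μ]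

/-- **Néel-weight ceiling from the `3 × 3` staggered spin box functional.**  For EVERY state `ω` on `ℤ²` and every
finite measure `μ` representing its `D₄`-orbit-mean spin correlation `spinOrbitCorr ω` (such a `μ` EXISTS for
translation-invariant `ω`: `spinOrbitCorr_representable`), the `(π,π)` Bragg weight — squared staggered magnetisation
per site of the translation-averaged state — is `≤ (9·c(0,0) − 24·c(1,0) + 16·c(1,1) + 12·c(2,0) − 16·c(2,1) + 4·c(2,2))/81`,
`c = Re spinOrbitCorr ω`.  A CEILING; silent on the presence of Néel order. [cite: Scalapino1995, §2] -/
theorem neel_braggWeight_le_boxStag3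
    (hμ : ∀ r : Site 2, ∫ ξ, exp ((∑ i, (r i : ℝ) * ξ i : ℝ) * I) ∂μ = spinOrbitCorr ω r) :
    braggWeight μ ![![π, π]] ≤
      (9 * (spinOrbitCorr ω ![0, 0]).re - 24 * (spinOrbitCorr ω ![1, 0]).re + 16 * (spinOrbitCorr ω ![1, 1]).re
        + 12 * (spinOrbitCorr ω ![2, 0]).re - 16 * (spinOrbitCorr ω ![2, 1]).re
        + 4 * (spinOrbitCorr ω ![2, 2]).re) / 81 :=
  braggWeight_pi_le_boxStag3 μ hμ (spinOrbitCorr_d4Vec ω)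

/-- **Uniform-magnetisation ceiling from the `3 × 3` unsigned spin box functional** (`F_s3` of the controls menu):
the `q = 0` spin Bragg weight — squared uniform magnetisation per site of the translation-averaged state, the
ferromagnetic order parameter — is at most `(9·c(0,0) + 24·c(1,0) + 16·c(1,1) + 12·c(2,0) + 16·c(2,1) + 4·c(2,2))/81`.
A CEILING; silent on the presence of ferromagnetism. [cite: Scalapino1995, §2] -/
theorem uniformSpin_braggWeight_le_box3
    (hμ : ∀ r : Site 2, ∫ ξ, exp ((∑ i, (r i : ℝ) * ξ i : ℝ) * I) ∂μ = spinOrbitCorr ω r) :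
    braggWeight μ ![(0 : Fin 2 → ℝ)] ≤
      (9 * (spinOrbitCorr ω ![0, 0]).re + 24 * (spinOrbitCorr ω ![1, 0]).re + 16 * (spinOrbitCorr ω ![1, 1]).re
        + 12 * (spinOrbitCorr ω ![2, 0]).re + 16 * (spinOrbitCorr ω ![2, 1]).re
        + 4 * (spinOrbitCorr ω ![2, 2]).re) / 81 :=
  braggWeight_zero_le_box3 μ hμ (spinOrbitCorr_d4Vec ω)

/-- **`q = 0` density-fluctuation ceiling from the `3 × 3` connected density box functional** (`F_c3` of the controls
menu): for every finite measure representing the `D₄`-orbit-mean CONNECTED density correlation `chargeOrbitCorr ω`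
(centred at density `7/8`; `chargeOrbitCorr_representable`), the `q = 0` Bragg weight — squared amplitude of macroscopic
density inhomogeneity of the translation-averaged state (phase-separation amplitude) — is at most the box mean.
A CEILING. [cite: Scalapino1995, §2] -/
theorem densityFluct_braggWeight_le_box3
    (hμ : ∀ r : Site 2, ∫ ξ, exp ((∑ i, (r i : ℝ) * ξ i : ℝ) * I) ∂μ = chargeOrbitCorr ω r) :
    braggWeight μ ![(0 : Fin 2 → ℝ)] ≤
      (9 * (chargeOrbitCorr ω ![0, 0]).re + 24 * (chargeOrbitCorr ω ![1, 0]).re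
        + 16 * (chargeOrbitCorr ω ![1, 1]).re + 12 * (chargeOrbitCorr ω ![2, 0]).re
        + 16 * (chargeOrbitCorr ω ![2, 1]).re + 4 * (chargeOrbitCorr ω ![2, 2]).re) / 81 :=
  braggWeight_zero_le_box3 μ hμ (chargeOrbitCorr_d4Vec ω)

/-- **Torus-limit form in the row currency (any `t′`).**  For every torus limit `ω` of unit
`(rectN (7/8) L, S^z = 0)`-sector ground states of `hubbardTorusTT' L 1 t′ 8` along `L → ∞` (the state binders of
`Rows/DopedTLCorr.lean` VERBATIM), IF the `3 × 3` staggered box functional in the engine's currency — the `r = 0` class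
folded as `¾(7/8 − 2·docc)` (`spinCorr_zero`; density `7/8` and translation invariance follow from the binders,
`m3_rowState_invariances`), the five other classes as orbit means `8⁻¹ Σ_γ C_ω(γ·r)` — is `≤ q` (what a certified
`D₄`-reduced UPPER row on `F_s3_stag` delivers after its dictionary), THEN for every finite measure `μ` representing
`spinOrbitCorr ω` the Néel weight obeys `μ((π,π) + 2πℤ²) ≤ q` (STEP-0 float preview `q ≈ 0.27` at `t′ = −1/4`, no
certificate; of record: `0.3399425` (#259) / `0.3360872` (#263)).  A CEILING. [cite: Scalapino1995, §2] -/
theorem neel_braggWeight_le_of_boxStag3_classRow {tp q : ℝ}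
    (Ls : ℕ → ℕ) (ψ : ∀ L, Fock (Orb (FermionTorus 2 L)))
    (hLs : Tendsto Ls atTop atTop)
    (hψ : ∀ j, IsGroundStateInSector (hubbardTorusTT' (Ls j) 1 tp 8) (rectN (7/8) (Ls j)) 0 (ψ (Ls j)))
    (hψ1 : ∀ j, star (ψ (Ls j)) ⬝ᵥ ψ (Ls j) = 1) (hlim : ω.IsTorusLimitOf ψ Ls)
    (hrow : (9 * (3/4 * (7/8 - 2 * docc ω))
        - 24 * ((8 : ℝ)⁻¹ * ∑ g : DihedralGroup 4, Certificates.spinCorr ω (d4Vec g ![1, 0]))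
        + 16 * ((8 : ℝ)⁻¹ * ∑ g : DihedralGroup 4, Certificates.spinCorr ω (d4Vec g ![1, 1]))
        + 12 * ((8 : ℝ)⁻¹ * ∑ g : DihedralGroup 4, Certificates.spinCorr ω (d4Vec g ![2, 0]))
        - 16 * ((8 : ℝ)⁻¹ * ∑ g : DihedralGroup 4, Certificates.spinCorr ω (d4Vec g ![2, 1]))
        + 4 * ((8 : ℝ)⁻¹ * ∑ g : DihedralGroup 4, Certificates.spinCorr ω (d4Vec g ![2, 2]))) / 81 ≤ q)
    (hμ : ∀ r : Site 2, ∫ ξ, exp ((∑ i, (r i : ℝ) * ξ i : ℝ) * I) ∂μ = spinOrbitCorr ω r) :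
    braggWeight μ ![![π, π]] ≤ q := by
  obtain ⟨hω, hn⟩ := m3_rowState_invariances hLs hψ hψ1 hlim
  have h := neel_braggWeight_le_boxStag3 ω μ hμ
  rw [spinOrbitCorr_re_zero hω hn, spinOrbitCorr_re ω ![1, 0], spinOrbitCorr_re ω ![1, 1],
    spinOrbitCorr_re ω ![2, 0], spinOrbitCorr_re ω ![2, 1], spinOrbitCorr_re ω ![2, 2]] at h
  exact h.trans hrow

/-- **Torus-limit form, uniform magnetisation (any `t′`)**: the unsigned twin — an UPPER row `≤ q` on `F_s3` in the
same currency bounds the squared uniform magnetisation per site, `μ(2πℤ²) ≤ q`, of every torus-limit ground state of the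
class (a-priori competitor: the Casimir budget `(n − 2·docc)/4 ≤ 7/32`, `StructureFactorsBraggBudget.lean`).  A CEILING.
[cite: Scalapino1995, §2] -/
theorem uniformSpin_braggWeight_le_of_box3_classRow {tp q : ℝ}
    (Ls : ℕ → ℕ) (ψ : ∀ L, Fock (Orb (FermionTorus 2 L)))
    (hLs : Tendsto Ls atTop atTop)
    (hψ : ∀ j, IsGroundStateInSector (hubbardTorusTT' (Ls j) 1 tp 8) (rectN (7/8) (Ls j)) 0 (ψ (Ls j)))
    (hψ1 : ∀ j, star (ψ (Ls j)) ⬝ᵥ ψ (Ls j) = 1) (hlim : ω.IsTorusLimitOf ψ Ls)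
    (hrow : (9 * (3/4 * (7/8 - 2 * docc ω))
        + 24 * ((8 : ℝ)⁻¹ * ∑ g : DihedralGroup 4, Certificates.spinCorr ω (d4Vec g ![1, 0]))
        + 16 * ((8 : ℝ)⁻¹ * ∑ g : DihedralGroup 4, Certificates.spinCorr ω (d4Vec g ![1, 1]))
        + 12 * ((8 : ℝ)⁻¹ * ∑ g : DihedralGroup 4, Certificates.spinCorr ω (d4Vec g ![2, 0]))
        + 16 * ((8 : ℝ)⁻¹ * ∑ g : DihedralGroup 4, Certificates.spinCorr ω (d4Vec g ![2, 1]))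
        + 4 * ((8 : ℝ)⁻¹ * ∑ g : DihedralGroup 4, Certificates.spinCorr ω (d4Vec g ![2, 2]))) / 81 ≤ q)
    (hμ : ∀ r : Site 2, ∫ ξ, exp ((∑ i, (r i : ℝ) * ξ i : ℝ) * I) ∂μ = spinOrbitCorr ω r) :
    braggWeight μ ![(0 : Fin 2 → ℝ)] ≤ q := by
  obtain ⟨hω, hn⟩ := m3_rowState_invariances hLs hψ hψ1 hlim
  have h := uniformSpin_braggWeight_le_box3 ω μ hμ
  rw [spinOrbitCorr_re_zero hω hn, spinOrbitCorr_re ω ![1, 0], spinOrbitCorr_re ω ![1, 1],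
    spinOrbitCorr_re ω ![2, 0], spinOrbitCorr_re ω ![2, 1], spinOrbitCorr_re ω ![2, 2]] at h
  exact h.trans hrow

end States

end Summit.Ventures.CertifiedManyBodySolver.Observables

end
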